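import Summits.BirchSwinnertonDyer.BirchSwinnertonDyer.Theorems.ClassRecordThreeEulerHalvesAtThreeCartanSupplyCubicPointsFixed
import HarnessLib

/-!
# Fixed points on the cubic points, II: the eigenvector count `#{v ≠ 0 : g v = a v, ∃ u, u³ det g = a²}` by eigenvalues

Helper file `--supports stmt-BirchSwinnertonDyer-23422` (seat `bsd-stepL-tam3-p1` g23, LINE OWNER of crux 23422 `EulerHalvesAtThreeResidualUpperBound`,
line `cartan` v11), serving the registered stub (SUPPLY) `stub_cartanTorusLatticeSupply : CartanCorrespondence.CartanTorusLatticeSupply` via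
`HOME/tam3-p1/g23/SUPPLY-ROAD-GG1.md` §1–§2. Part I (`…CubicPointsFixed`) reduced `#{x : x⁻¹ g x ∈ H}` to `(q² − q)·E(g)` with
`E(g) = #{v ≠ 0 : ∃ a, g v = a v ∧ ∃ u, u³ det g = a²}`. THIS FILE evaluates `E(g)`:
* `card_eigvec_eq_sum` : `E(g) = Σ_{a : ∃u, u³ det g = a²} (#{v : (g − a·1) v = 0} − 1)` (a non-zero eigenvector has exactly one eigenvalue);
* `E(g) = q² − 1` for scalar `g` (`card_eigvec_of_isScalar`); for NON-scalar `g`, `#{v : (g − a·1)v = 0} − 1 = (q − 1)·[a is an eigenvalue]`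
  (`card_ker_sub_smul_of_not_isScalar`, from `…KernelCounts`), hence `E(g) = (q − 1) · #{a : a² + det g = tr g · a ∧ ∃ u, u³ det g = a²}`
  (`card_eigvec_of_not_isScalar`) — `0` without rational eigenvalue, `1·(q−1)` when `Δ = 0` (the double root `a` has `a² = det g`, `u = 1`), and for two
  roots `λ ≠ μ` the condition holds at both or at neither (`∃ u, u³ = λ/μ`), Part III.
HONEST FRAMING: finite-field counting; nothing about SUPPLY, NUM, crux 23422 ∕ 19109 is proved here; BSD is proved for no curve. [folklore]
-/

namespace Summit.BirchSwinnertonDyer.BirchSwinnertonDyer.Theorems.CartanSupply.CubicPointsFixed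

open Summit.BirchSwinnertonDyer.BirchSwinnertonDyer.Theorems.CartanDegree
open Summit.BirchSwinnertonDyer.BirchSwinnertonDyer.Theorems.CartanTorusCubeCut
open Summit.BirchSwinnertonDyer.BirchSwinnertonDyer.Theorems.CartanSupply.KernelCounts

set_option linter.dupNamespace false
set_option autoImplicit false

open scoped Classical

variable {q : ℕ} [Fact q.Prime]

/-! ## §1 One eigenvalue per non-zero eigenvector -/

/-- PROVED: `g v = a v ⟺ (g − a·1) v = 0`. [folklore] -/
theorem mulVec_eq_smul_iff (M : Mat q) (a : ZMod q) (v : Fin 2 → ZMod q) :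
    M.mulVec v = a • v ↔ (M - a • (1 : Mat q)).mulVec v = 0 := by
  rw [Matrix.sub_mulVec, Matrix.smul_mulVec, Matrix.one_mulVec, sub_eq_zero]

/-- PROVED: a non-zero vector has at most one eigenvalue. [folklore] -/
theorem eigenvalue_unique {M : Mat q} {v : Fin 2 → ZMod q} (hv : v ≠ 0) {a b : ZMod q}
    (ha : M.mulVec v = a • v) (hb : M.mulVec v = b • v) : a = b := by
  have h : (a - b) • v = 0 := by rw [sub_smul, ← ha, ← hb, sub_self]
  by_contra hab
  exact hv ((smul_eq_zero.mp h).resolve_left (sub_ne_zero.mpr hab))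

/-- PROVED — **`E(g)` AS A SUM OVER EIGENVALUES**: `#{v ≠ 0 : ∃ a, g v = a v ∧ C a} = Σ_{a : C a} (#{v : (g − a·1)v = 0} − 1)` for any condition
`C` on the eigenvalue. [folklore] -/
theorem card_eigvec_eq_sum (M : Mat q) (C : ZMod q → Prop) :
    (Finset.univ.filter fun v : Fin 2 → ZMod q => v ≠ 0 ∧ ∃ a : ZMod q, M.mulVec v = a • v ∧ C a).card =
      ∑ a ∈ Finset.univ.filter C, ((Finset.univ.filter fun v : Fin 2 → ZMod q => (M - a • (1 : Mat q)).mulVec v = 0).card - 1) := by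
  -- the set is the disjoint union over `a` with `C a` of the punctured eigenspaces
  have hdecomp : (Finset.univ.filter fun v : Fin 2 → ZMod q => v ≠ 0 ∧ ∃ a : ZMod q, M.mulVec v = a • v ∧ C a) =
      (Finset.univ.filter C).biUnion (fun a => (Finset.univ.filter fun v : Fin 2 → ZMod q => (M - a • (1 : Mat q)).mulVec v = 0).erase 0) := by
    ext v
    simp only [Finset.mem_filter, Finset.mem_univ, true_and, Finset.mem_biUnion, Finset.mem_erase]
    constructor
    · rintro ⟨hv, a, ha, hC⟩
      exact ⟨a, hC, hv, (mulVec_eq_smul_iff M a v).mp ha⟩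
    · rintro ⟨a, hC, hv, ha⟩
      exact ⟨hv, a, (mulVec_eq_smul_iff M a v).mpr ha, hC⟩
  rw [hdecomp, Finset.card_biUnion]
  · apply Finset.sum_congr rfl
    intro a _
    rw [Finset.card_erase_of_mem]
    simp
  · -- pairwise disjoint: one eigenvalue per non-zero vector
    intro a _ b _ hab
    rw [Function.onFun, Finset.disjoint_left]
    intro v hva hvb
    rw [Finset.mem_erase, Finset.mem_filter] at hva hvb
    exact hab (eigenvalue_unique hva.1 ((mulVec_eq_smul_iff M a v).mpr hva.2.2) ((mulVec_eq_smul_iff M b v).mpr hvb.2.2))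

/-! ## §2 Scalar and non-scalar `g` -/

/-- PROVED: `M − a·1` vanishes iff `M` is the scalar matrix `a·1`. [folklore] -/
theorem sub_smul_one_eq_zero_iff (M : Mat q) (a : ZMod q) : M - a • (1 : Mat q) = 0 ↔ M = a • (1 : Mat q) := sub_eq_zero

/-- PROVED: `det(M − a·1) = a² + det M − tr M·a`; so it vanishes iff `a` is a rational eigenvalue (`a·a + det M = tr M·a`). [folklore] -/
theorem det_sub_smul_one (M : Mat q) (a : ZMod q) : (M - a • (1 : Mat q)).det = a * a + M.det - M.trace * a := by
  rw [Matrix.det_fin_two, Matrix.det_fin_two, Matrix.trace_fin_two]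
  simp
  ring

/-- PROVED: for NON-SCALAR `M`, the kernel of `M − a·1` has `q` elements if `a` is a rational eigenvalue and `1` element otherwise. [folklore] -/
theorem card_ker_sub_smul_of_not_isScalar (M : Mat q) (hM : ¬ IsScalarMat M) (a : ZMod q) :
    (Finset.univ.filter fun v : Fin 2 → ZMod q => (M - a • (1 : Mat q)).mulVec v = 0).card =
      if a * a + M.det = M.trace * a then q else 1 := by
  have hne : M - a • (1 : Mat q) ≠ 0 := by
    intro h
    apply hM
    rw [sub_smul_one_eq_zero_iff] at h
    rw [h]
    refine ⟨by simp, by simp, by simp⟩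
  by_cases ha : a * a + M.det = M.trace * a
  · rw [if_pos ha]
    apply card_ker_of_det_eq_zero _ hne
    rw [det_sub_smul_one, ha, sub_self]
  · rw [if_neg ha]
    apply card_ker_of_det_ne_zero
    rw [det_sub_smul_one]
    intro h
    exact ha (by linear_combination h)

/-- PROVED — **SCALAR `g = λ·1`**: every non-zero vector is an eigenvector (eigenvalue `λ`, `λ²/det = 1` a cube): `E(g) = q² − 1`. [folklore] -/
theorem card_eigvec_of_isScalar (g : G q) (hs : IsScalarMat (g : Mat q)) :
    (Finset.univ.filter fun v : Fin 2 → ZMod q => v ≠ 0 ∧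
        ∃ a : ZMod q, (g : Mat q).mulVec v = a • v ∧ ∃ u : ZMod q, u ^ 3 * (g : Mat q).det = a ^ 2).card = q ^ 2 - 1 := by
  obtain ⟨h01, h10, h00⟩ := hs
  set c : ZMod q := (g : Mat q) 0 0 with hc
  have hg : (g : Mat q) = c • (1 : Mat q) := by
    ext i j
    fin_cases i <;> fin_cases j <;> simp [h01, h10, ← h00, hc]
  have hall : (Finset.univ.filter fun v : Fin 2 → ZMod q => v ≠ 0 ∧
        ∃ a : ZMod q, (g : Mat q).mulVec v = a • v ∧ ∃ u : ZMod q, u ^ 3 * (g : Mat q).det = a ^ 2) =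
      Finset.univ.filter fun v : Fin 2 → ZMod q => v ≠ 0 := by
    apply Finset.filter_congr
    intro v _
    constructor
    · exact fun h => h.1
    · intro hv
      refine ⟨hv, c, ?_, 1, ?_⟩
      · rw [hg, Matrix.smul_mulVec, Matrix.one_mulVec]
      · rw [hg, Matrix.det_smul, Matrix.det_one, Fintype.card_fin]; ring
  rw [hall, Finset.filter_ne' Finset.univ (0 : Fin 2 → ZMod q), Finset.card_erase_of_mem (Finset.mem_univ _), Finset.card_univ,
    Fintype.card_fun, ZMod.card, Fintype.card_fin]

/-- PROVED — **NON-SCALAR `g`**: `E(g) = (q − 1) · #{a : a rational eigenvalue with a²/det g a cube}`. [folklore] -/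
theorem card_eigvec_of_not_isScalar (g : G q) (hs : ¬ IsScalarMat (g : Mat q)) :
    (Finset.univ.filter fun v : Fin 2 → ZMod q => v ≠ 0 ∧
        ∃ a : ZMod q, (g : Mat q).mulVec v = a • v ∧ ∃ u : ZMod q, u ^ 3 * (g : Mat q).det = a ^ 2).card =
      (q - 1) * (Finset.univ.filter fun a : ZMod q =>
        a * a + (g : Mat q).det = (g : Mat q).trace * a ∧ ∃ u : ZMod q, u ^ 3 * (g : Mat q).det = a ^ 2).card := by
  have h0 := card_eigvec_eq_sum (g : Mat q) (fun a => ∃ u : ZMod q, u ^ 3 * (g : Mat q).det = a ^ 2)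
  beta_reduce at h0
  have h0' : (Finset.univ.filter fun v : Fin 2 → ZMod q => v ≠ 0 ∧
        ∃ a : ZMod q, (g : Mat q).mulVec v = a • v ∧ ∃ u : ZMod q, u ^ 3 * (g : Mat q).det = a ^ 2).card =
      ∑ a ∈ Finset.univ.filter (fun a : ZMod q => ∃ u : ZMod q, u ^ 3 * (g : Mat q).det = a ^ 2),
        ((Finset.univ.filter fun v : Fin 2 → ZMod q => ((g : Mat q) - a • (1 : Mat q)).mulVec v = 0).card - 1) := by
    convert h0 using 3
  rw [h0']
  simp_rw [card_ker_sub_smul_of_not_isScalar (g : Mat q) hs]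
  -- split the sum according to whether `a` is an eigenvalue
  rw [Finset.card_eq_sum_ones, Finset.mul_sum, mul_one]
  rw [← Finset.sum_filter_add_sum_filter_not (Finset.univ.filter fun a : ZMod q => ∃ u : ZMod q, u ^ 3 * (g : Mat q).det = a ^ 2)
    (fun a => a * a + (g : Mat q).det = (g : Mat q).trace * a)]
  have h1 : ∑ a ∈ (Finset.univ.filter fun a : ZMod q => ∃ u : ZMod q, u ^ 3 * (g : Mat q).det = a ^ 2).filter
        (fun a => a * a + (g : Mat q).det = (g : Mat q).trace * a),
      ((if a * a + (g : Mat q).det = (g : Mat q).trace * a then q else 1) - 1) =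
      ∑ a ∈ (Finset.univ.filter fun a : ZMod q =>
        a * a + (g : Mat q).det = (g : Mat q).trace * a ∧ ∃ u : ZMod q, u ^ 3 * (g : Mat q).det = a ^ 2), (q - 1) := by
    rw [Finset.filter_filter]
    apply Finset.sum_congr
    · ext a; simp only [Finset.mem_filter, Finset.mem_univ, true_and]; tauto
    · intro a ha
      rw [Finset.mem_filter] at ha
      rw [if_pos ha.2.1]
  have h2 : ∑ a ∈ (Finset.univ.filter fun a : ZMod q => ∃ u : ZMod q, u ^ 3 * (g : Mat q).det = a ^ 2).filter
        (fun a => ¬ (a * a + (g : Mat q).det = (g : Mat q).trace * a)),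
      ((if a * a + (g : Mat q).det = (g : Mat q).trace * a then q else 1) - 1) = 0 := by
    apply Finset.sum_eq_zero
    intro a ha
    rw [Finset.mem_filter] at ha
    rw [if_neg ha.2]
    rfl
  rw [h1, h2, add_zero, Finset.sum_const, smul_eq_mul, mul_comm]

end Summit.BirchSwinnertonDyer.BirchSwinnertonDyer.Theorems.CartanSupply.CubicPointsFixed
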